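import Literature.NumberTheory.Automorphic.UnitaryGroupBorelHeightBigCell
import Literature.NumberTheory.Automorphic.UnitaryGroupTruncationFiniteSumTwo
import HarnessLib

/-!
# `U(J₂)`: off the Borel means in the big cell — `H(γ g) · H(g) ≤ 1` for every `γ ∈ U(J₂)(F) ∖ B(F)`
# (the `N = 2` twin of ★ `UnitaryGroupBorelHeightBigCell` §4)

Topic `NumberTheory/Automorphic`; namespace `Literature.NumberTheory.Automorphic.UnitaryGroup`.
Proof file: theorems only (no definition, no named fact, no instance, no `sorry`); imports = tree.
H-side copy of LAWS 1–5 for `H = U(Φ₂) × U(Φ₁)` (hodgecm-mathlib, F0P3a LEAD WORD #123; census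
`CENSUS-LAWS-Hside` §2): ★ `UnitaryGroupBorelHeightBigCell` §§1–3 are rank-generic
(`one_le_vecHeight_lastRow_mul`, `borelHeight_toAdelic_mul_mul_borelHeight_le_one`,
`borelHeight_toAdelic_mul_lt_one` hold on `U(J_N)` for `γ` in the big cell `γ_{N,1} ≠ 0`), while its §4
«off the Borel means in the big cell» is typed for `U(J₃)` (and is false for `N ≥ 4`, where the Bruhat
decomposition has more than two cells). This file is the `U(J₂)` twin of §4: for a `2 × 2` unitary
matrix `γ`, `γ ∉ B` iff `γ₁₀ ≠ 0` (★ `mem_borelAdelic_toAdelic_of_lastRow_eq_smul_two`), so the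
Siegel property **`H(γ g) · H(g) ≤ 1` for `γ ∈ G(F) ∖ B(F)`** — the `U(J₂)` analogue of
`Im(γ z) · Im(z) ≤ 1` — follows from §3 of the generic file (Rogawski (1990), §2.2 p. 13, the same
reduction theory serving `U(2)` and `U(2) × U(1)` on p. 98; Garrett (2018), §1.5, §2.3).

## References

* J. D. Rogawski, *Automorphic Representations of Unitary Groups in Three Variables*, Ann. of Math.
  Stud. 123 (1990), §1.10, §2.2 p. 13 [Rogawski1990].
* P. Garrett, *Modern Analysis of Automorphic Forms by Example* (2018), §1.5, §2.2–§2.3 [Garrett2018].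
-/

set_option autoImplicit false

noncomputable section

open NumberField IsDedekindDomain Matrix
open scoped NNReal MatrixGroups

namespace Literature.NumberTheory.Automorphic

namespace UnitaryGroup

variable {F E : Type} [Field F] [NumberField F] [Field E] [NumberField E] [Algebra F E] {c : E ≃ₐ[F] E}

/-- **For `U(J₂)`: `γ ∉ B` ⇒ `γ₁₀ ≠ 0`.** If the entry `(1, 0)` of the rational `2 × 2` matrix `γ`
vanishes, its last row is `(0, γ₁₁) = γ₁₁ · e₂` and `γ` is upper triangular
(★ `mem_borelAdelic_toAdelic_of_lastRow_eq_smul_two`): the Bruhat decomposition `G = B ⊔ B w B` of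
the rank-one group `U(J₂)` read on last rows. [cite: Rogawski1990, §1.10] -/
theorem apply_top_zero_ne_zero_of_not_mem_borelAdelic_two {γ : (quasiSplit F E c 2).Rational}
    (hγ : (quasiSplit F E c 2).toAdelic γ ∉ borelAdelic F E c 2) :
    ((γ.1 : GL (Fin 2) E) : Matrix (Fin 2) (Fin 2) E) ⊤ 0 ≠ 0 := by
  intro h0
  apply hγ
  set A : Matrix (Fin 2) (Fin 2) E := ((γ.1 : GL (Fin 2) E) : Matrix (Fin 2) (Fin 2) E) with hA
  have htop : (⊤ : Fin 2) = 1 := rfl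
  have h10 : A 1 0 = 0 := by rw [← htop]; exact h0
  refine mem_borelAdelic_toAdelic_of_lastRow_eq_smul_two (a := A 1 1) (funext fun j => ?_)
  rw [htop]
  fin_cases j
  · simp [← hA, h10]
  · simp [← hA]

/-- **`H(γ g) · H(g) ≤ 1` for every `γ ∈ U(J₂)(F) ∖ B(F)` and every `g ∈ U(J₂)(𝔸_F)`** (rational
points as ★ `quasiSplit.Rational`, `B(𝔸_F)` = ★ `borelAdelic`): the generic big-cell inequality ★
`borelHeight_toAdelic_mul_mul_borelHeight_le_one` at `N = 2`. [cite: Garrett2018, §1.5 and §2.3]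
[cite: Rogawski1990, §2.2 p. 13] -/
theorem borelHeight_mul_borelHeight_le_one_of_not_mem_borelAdelic_two {γ : (quasiSplit F E c 2).Rational}
    (hγ : (quasiSplit F E c 2).toAdelic γ ∉ borelAdelic F E c 2) (g : (quasiSplit F E c 2).Adelic) :
    borelHeight ((quasiSplit F E c 2).toAdelic γ * g) * borelHeight g ≤ 1 :=
  borelHeight_toAdelic_mul_mul_borelHeight_le_one γ (apply_top_zero_ne_zero_of_not_mem_borelAdelic_two hγ) g

/-- The same for `γ` in the arithmetic subgroup `G(F) ≤ G(𝔸_F)` of `U(J₂)` off ★ `arithmeticBorel`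
(the currency of ★ `pseudoEisenstein` ∕ ★ `truncatedKernel`): **`H(γ g) · H(g) ≤ 1`**.
[cite: Garrett2018, §1.5 and §2.3] [cite: Rogawski1990, §2.2 p. 13] -/
theorem borelHeight_mul_borelHeight_le_one_of_not_mem_arithmeticBorel_two
    {γ : (quasiSplit F E c 2).arithmeticSubgroup}
    (hγ : γ ∉ arithmeticBorel F E c 2) (g : (quasiSplit F E c 2).Adelic) :
    borelHeight ((γ : (quasiSplit F E c 2).Adelic) * g) * borelHeight g ≤ 1 := by
  obtain ⟨γ₀, hγ₀⟩ := MonoidHom.mem_range.mp γ.2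
  rw [← hγ₀]
  refine borelHeight_mul_borelHeight_le_one_of_not_mem_borelAdelic_two (fun h => hγ ?_) g
  rw [mem_arithmeticBorel_iff, ← hγ₀]
  exact h

/-- **At most one of `g`, `γ g` is high in the cusp** (`U(J₂)`, `γ ∈ G(F) ∖ B(F)`):
`H(g) > 1 ⇒ H(γ g) < 1`. [cite: Garrett2018, §2.3] -/
theorem borelHeight_mul_lt_one_of_not_mem_arithmeticBorel_two {γ : (quasiSplit F E c 2).arithmeticSubgroup}
    (hγ : γ ∉ arithmeticBorel F E c 2) {g : (quasiSplit F E c 2).Adelic} (hg : 1 < borelHeight g) :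
    borelHeight ((γ : (quasiSplit F E c 2).Adelic) * g) < 1 := by
  obtain ⟨γ₀, hγ₀⟩ := MonoidHom.mem_range.mp γ.2
  rw [← hγ₀]
  refine borelHeight_toAdelic_mul_lt_one γ₀ (apply_top_zero_ne_zero_of_not_mem_borelAdelic_two fun h => hγ ?_) hg
  rw [mem_arithmeticBorel_iff, ← hγ₀]
  exact h

end UnitaryGroup

end Literature.NumberTheory.Automorphic
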